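import Literature.Analysis.FluidPDE.NSUniqueness2HalfD
import Literature.Analysis.FluidPDE.SerrinEnstrophyGronwall
import HarnessLib

/-!
# Stability of two-and-a-half-dimensional Leray–Hopf flows under three-dimensional
perturbations on `T³` (Bardos–Lopes Filho–Niu–Nussenzveig Lopes–Titi 2013, Thm. 3.1)

Analysis/FluidPDE file (theorem-only). The sibling `NSUniqueness2HalfD` proves the difference
energy inequality `Torus.IsLerayHopfOn.lintegral_enorm_sub_sq_add_le_of_invariant` for a
three-dimensional Leray–Hopf perturbation `u` of an `x₃`-independent Leray–Hopf solution `U` on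
the flat torus `T³`, and from it the *uniqueness* corollary (op. cit., Remark 3.1) by the
homogeneous Grönwall lemma. This file proves the theorem itself — the **global-in-time
stability estimate** (op. cit., Thm. 3.1: on `C = D × (0,L)`,
`‖v - u‖²(t) ≤ ‖v₀ - u₀‖² exp(27‖u₀‖⁴_{L²(D)}/(64ν⁴))` for all `t ≥ 0`), in the torus form
with the tree's inhomogeneous anisotropic Ladyzhenskaya constant `C = Torus.anisotropicConst`:

* `Torus.IsLerayHopfOn.lintegral_enorm_sub_sq_le_mul_exp_of_invariant` — `ℝ≥0∞` form with the
  Grönwall kernel `a(s) = ν + ν⁻¹(18C)²‖∇U(s)‖₂²`: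
  `∫‖u(t)-U(t)‖² ≤ ∫‖u₀-U₀‖² · exp ∫₀ᵗ a` for `t ∈ (0,T]` (difference inequality, Young,
  `lintegral_gronwall_le` — Robinson–Rodrigo–Sadowski 2016, Lemma A.25 — applied to the
  extension of `t ↦ ∫‖u(t)-U(t)‖²` by `0` at `t = 0`, where the slices are not pinned).
* `Torus.IsLerayHopfOn.toReal_lintegral_stabilityKernel_le` — the kernel integral is finite and
  `∫₀ᵗ a ≤ ν t + 162 C² ‖U₀‖₂²/ν²` (energy inequality `2ν∫₀ᵗ‖∇U‖₂² ≤ ‖U₀‖₂²`).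
* `Torus.IsLerayHopfOn.integral_norm_sub_sq_le_mul_exp_of_invariant` — the real, explicit
  form `∫‖u(t)-U(t)‖² ≤ ∫‖u₀-U₀‖² · exp(ν t + 162 C²‖U₀‖₂²/ν²)`.

The modulus degenerates like `exp(c/ν²)` as `ν → 0` (printed: `exp(c/ν⁴)` with the homogeneous
Ladyzhenskaya inequality of the no-slip cylinder): the estimate gives continuous dependence on
the data for fixed `ν` ("this solution depends continuously on the initial data, when the initial
data is perturbed in the `L²(T³)` norm (see [BLNNT])", Bardos–Titi–Wiedemann 2012, proof of
Thm. 5) but no uniform-in-`ν` stability; this is what limits the vanishing-viscosity selection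
theorem to exponentially accurate data (op. cit. 2013, §4, Thm. 4.4; see
`Literature/Barriers/AnomalousDissipation/ShearFlowViscositySelectionPerturbed.lean`).
Nothing here is specific to shear data: `U₀` is any `L²` datum whose Leray–Hopf solution `U`
has `x₃`-independent slices.

## References

* C. Bardos, M. C. Lopes Filho, D. Niu, H. J. Nussenzveig Lopes, E. S. Titi, *Stability of
  two-dimensional viscous incompressible flows under three-dimensional perturbations and
  inviscid symmetry breaking*, SIAM J. Math. Anal. 45 (2013) 1871–1885 = arXiv:1201.2742,
  Thm. 3.1 and its proof, §4 and Thm. 4.4. [BardosEtAl2013]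
* C. Bardos, E. S. Titi, E. Wiedemann, C. R. Math. Acad. Sci. Paris 350 (2012) 757–760,
  proof of Thm. 5. [BardosTitiWiedemann2012]
* J. C. Robinson, J. L. Rodrigo, W. Sadowski, *The three-dimensional Navier–Stokes equations*,
  CUP 2016, Lemma A.25 (Grönwall). [RobinsonRodrigoSadowski2016]
-/

open MeasureTheory Set Filter Topology UnitAddTorus Function
open scoped ENNReal NNReal InnerProductSpace

noncomputable section

namespace Literature.Analysis.FluidPDE

open FunctionSpaces

/-- **Stability of `x₃`-independent Leray–Hopf flows under three-dimensional perturbations,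
`ℝ≥0∞` Grönwall form** (Bardos–Lopes Filho–Niu–Nussenzveig Lopes–Titi 2013, Thm. 3.1 and
its proof, on the flat torus `T³`). Let `u`, `U` be Leray–Hopf weak solutions of the unforced
Navier–Stokes equations on `T³ × [0,T)` with viscosity `ν > 0` and `L²` data `u₀`, `U₀`, every
slice of `U` being independent of the third coordinate. Then for every `t ∈ (0,T]`
`∫‖u(t) - U(t)‖² ≤ ∫‖u₀ - U₀‖² · exp(∫₀ᵗ (ν + ν⁻¹(18C)²‖∇U(s)‖₂²) ds)`, `C = Torus.anisotropicConst`
(spectral dissipation `Torus.eGradNormSq`). Proof: the difference energy inequality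
`Torus.IsLerayHopfOn.lintegral_enorm_sub_sq_add_le_of_invariant` (Serrin's inequality (27) plus
the sliced Ladyzhenskaya bound), Young's inequality to absorb `2ν∫‖∇w‖²`, and the integral
Grönwall lemma `lintegral_gronwall_le` on `[0,T]` applied to `t ↦ ∫‖u(t)-U(t)‖²` extended by
`0` at `t = 0`. [cite: BardosEtAl2013, Thm. 3.1] -/
theorem Torus.IsLerayHopfOn.lintegral_enorm_sub_sq_le_mul_exp_of_invariant {T ν : ℝ}
    {u U : ℝ → UnitAddTorus (Fin 3) → EuclideanSpace ℝ (Fin 3)}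
    {u₀ U₀ : UnitAddTorus (Fin 3) → EuclideanSpace ℝ (Fin 3)}
    (hu : Torus.IsLerayHopfOn T ν 0 u₀ u) (hU : Torus.IsLerayHopfOn T ν 0 U₀ U) (hν : 0 < ν) (hT : 0 < T)
    (hu₀ : MemLp u₀ 2 volume) (hU₀ : MemLp U₀ 2 volume)
    (hUinv : ∀ (t : ℝ) (s : UnitAddCircle) (x : UnitAddTorus (Fin 3)), U t (x + Pi.single (2 : Fin 3) s) = U t x) :
    ∀ t ∈ Ioc 0 T, (∫⁻ x, ‖u t x - U t x‖ₑ ^ 2) ≤ (∫⁻ x, ‖u₀ x - U₀ x‖ₑ ^ 2) *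
      ENNReal.ofReal (Real.exp (∫⁻ s in Ioo 0 t, (ENNReal.ofReal ν +
        (ENNReal.ofReal ν)⁻¹ * (2 * (9 * Torus.anisotropicConst)) ^ 2 * Torus.eGradNormSq (U s))).toReal) := by
  -- ### notation
  set y : ℝ → ℝ≥0∞ := fun s => ∫⁻ x, ‖u s x - U s x‖ₑ ^ 2 with hy
  set g : ℝ → ℝ≥0∞ := fun s => Torus.eGradNormSq (u s - U s) with hg
  set e : ℝ → ℝ≥0∞ := fun s => Torus.eGradNormSq (U s) with he
  set νe : ℝ≥0∞ := ENNReal.ofReal ν with hνe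
  have hνe0 : νe ≠ 0 := by rw [hνe]; simpa using hν
  have hνetop : νe ≠ ⊤ := ENNReal.ofReal_ne_top
  set C9 : ℝ≥0∞ := 9 * Torus.anisotropicConst with hC9
  have hC9top : C9 ≠ ⊤ := ENNReal.mul_ne_top (by norm_num) Torus.anisotropicConst_ne_top
  set Kc : ℝ≥0∞ := νe⁻¹ * (2 * C9) ^ 2 with hKc
  have hKctop : Kc ≠ ⊤ := ENNReal.mul_ne_top (ENNReal.inv_ne_top.2 hνe0)
    (ENNReal.pow_ne_top (ENNReal.mul_ne_top ENNReal.ofNat_ne_top hC9top))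
  set a : ℝ → ℝ≥0∞ := fun s => νe + Kc * e s with ha
  have ha' : ∀ s, ENNReal.ofReal ν + (ENNReal.ofReal ν)⁻¹ * (2 * (9 * Torus.anisotropicConst)) ^ 2 *
      Torus.eGradNormSq (U s) = a s := fun s => by
    simp only [ha, hKc, hC9, hνe, he]
  set B : ℝ≥0∞ := ∫⁻ x, ‖u₀ x - U₀ x‖ₑ ^ 2 with hB
  have hBtop : B ≠ ⊤ := by
    have h := Torus.lintegral_enorm_sq_eq_ofReal (hu₀.sub hU₀)
    simp only [Pi.sub_apply] at h
    rw [hB, h]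
    exact ENNReal.ofReal_ne_top
  -- ### forces and measurability
  have hf0m : AEStronglyMeasurable (Torus.stLift (0 : ℝ → UnitAddTorus (Fin 3) → EuclideanSpace ℝ (Fin 3)))
      (volume.restrict (Ioo 0 T ×ˢ univ)) := aestronglyMeasurable_const (b := (0 : EuclideanSpace ℝ (Fin 3)))
  have hf0 : ∫⁻ s in Ioo 0 T, ∫⁻ x : UnitAddTorus (Fin 3), ‖(0 : ℝ → UnitAddTorus (Fin 3) → EuclideanSpace ℝ (Fin 3)) s x‖ₑ ^ 2 < ⊤ := by simp
  have hu' := hu.aestronglyMeasurable_uncurry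
  have hU' := hU.aestronglyMeasurable_uncurry
  have hy_meas : AEMeasurable y (volume.restrict (Ioo 0 T)) :=
    ((hu'.sub hU').aemeasurable.enorm.pow_const 2).lintegral_prod_right'
  have he_meas : AEMeasurable e (volume.restrict (Ioo 0 T)) := hU.aemeasurable_eGradNormSq
  -- ### uniform `L²` bounds on `[0, T]`
  obtain ⟨Mu, hMu, hMu'⟩ := hu.exists_forall_lintegral_enorm_sq_le hν.le hf0m hf0
  obtain ⟨MU, hMU, hMU'⟩ := hU.exists_forall_lintegral_enorm_sq_le hν.le hf0m hf0
  have hybound : ∀ t ∈ Ioc 0 T, y t ≤ 2 * Mu + 2 * MU := by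
    intro t ht
    have ht' : t ∈ Icc 0 T := ⟨ht.1.le, ht.2⟩
    have hmu : AEMeasurable (fun x => ‖u t x‖ₑ ^ 2) volume := (hu.memLp t ht').aestronglyMeasurable.enorm.pow_const _
    calc y t ≤ ∫⁻ x, (2 * ‖u t x‖ₑ ^ 2 + 2 * ‖U t x‖ₑ ^ 2) := lintegral_mono fun x => enorm_sub_sq_le_two_mul _ _
      _ = 2 * (∫⁻ x, ‖u t x‖ₑ ^ 2) + 2 * ∫⁻ x, ‖U t x‖ₑ ^ 2 := by
          rw [lintegral_add_left' (hmu.const_mul _), lintegral_const_mul' _ _ ENNReal.ofNat_ne_top,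
            lintegral_const_mul' _ _ ENNReal.ofNat_ne_top]
      _ ≤ 2 * Mu + 2 * MU := by gcongr <;> [exact hMu' t ht'; exact hMU' t ht']
  -- ### the kernel `a` is integrable on `(0, T)`
  have haT : ∫⁻ s in Ioo 0 T, a s ≠ ⊤ := by
    have : ∫⁻ s in Ioo 0 T, a s = (∫⁻ _ in Ioo 0 T, νe) + Kc * ∫⁻ s in Ioo 0 T, e s := by
      rw [ha, lintegral_add_left' aemeasurable_const, lintegral_const_mul' _ _ hKctop]
    rw [this, setLIntegral_const]
    exact ENNReal.add_ne_top.2 ⟨ENNReal.mul_ne_top hνetop measure_Ioo_lt_top.ne,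
      ENNReal.mul_ne_top hKctop hU.lintegral_eGradNormSq_lt_top.ne⟩
  -- ### the integral inequality `y t ≤ B + ∫₀ᵗ a y` on `(0, T]`
  have hmain : ∀ t ∈ Ioc 0 T, y t ≤ B + ∫⁻ s in Ioo 0 t, a s * y s := by
    intro t ht
    have hsub : Ioo 0 t ⊆ Ioo 0 T := Ioo_subset_Ioo le_rfl ht.2
    set μ : Measure ℝ := volume.restrict (Ioo 0 t) with hμ
    have hle : μ ≤ volume.restrict (Ioo 0 T) := Measure.restrict_mono hsub le_rfl
    have hym : AEMeasurable y μ := hy_meas.mono_measure hle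
    have hem : AEMeasurable e μ := he_meas.mono_measure hle
    obtain ⟨hGfin, -⟩ := hu.toReal_lintegral_eGradNormSq_sub hU ht.2
    set G : ℝ≥0∞ := ∫⁻ s in Ioo 0 t, g s with hG
    have hD := hu.lintegral_enorm_sub_sq_add_le_of_invariant hU hν.le hT hu₀ hU₀ hUinv ht
    -- pointwise Young
    have hpt : ∀ s, 2 * C9 * ((y s ^ (1 / 4 : ℝ) * (y s + g s) ^ (1 / 4 : ℝ)) * (y s ^ (1 / 4 : ℝ) * (y s + g s) ^ (1 / 4 : ℝ)) *
        e s ^ (1 / 2 : ℝ)) ≤ νe * (y s + g s) + Kc * e s * y s := by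
      intro s
      have h1 : 2 * C9 * ((y s ^ (1 / 4 : ℝ) * (y s + g s) ^ (1 / 4 : ℝ)) * (y s ^ (1 / 4 : ℝ) * (y s + g s) ^ (1 / 4 : ℝ)) *
          e s ^ (1 / 2 : ℝ)) = 2 * C9 * (y s + g s) ^ (1 / 2 : ℝ) * (y s * e s) ^ (1 / 2 : ℝ) := by
        rw [ENNReal.mul_rpow_of_nonneg _ _ (by norm_num : (0 : ℝ) ≤ 1 / 2), ← ENNReal.rpow_quarter_mul_rpow_quarter (y s),
          ← ENNReal.rpow_quarter_mul_rpow_quarter (y s + g s)]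
        ring
      rw [h1]
      calc 2 * C9 * (y s + g s) ^ (1 / 2 : ℝ) * (y s * e s) ^ (1 / 2 : ℝ) ≤ νe * (y s + g s) + νe⁻¹ * (2 * C9) ^ 2 * (y s * e s) :=
            ENNReal.mul_rpow_half_mul_rpow_half_le _ _ _ hνe0 hνetop
        _ = νe * (y s + g s) + Kc * e s * y s := by rw [hKc]; ring
    have hint : 2 * C9 * ∫⁻ s in Ioo 0 t, ((y s ^ (1 / 4 : ℝ) * (y s + g s) ^ (1 / 4 : ℝ)) *
        (y s ^ (1 / 4 : ℝ) * (y s + g s) ^ (1 / 4 : ℝ)) * e s ^ (1 / 2 : ℝ)) ≤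
        νe * (∫⁻ s in Ioo 0 t, y s) + νe * G + ∫⁻ s in Ioo 0 t, Kc * e s * y s := by
      rw [← lintegral_const_mul' _ _ (ENNReal.mul_ne_top ENNReal.ofNat_ne_top hC9top)]
      calc ∫⁻ s in Ioo 0 t, 2 * C9 * ((y s ^ (1 / 4 : ℝ) * (y s + g s) ^ (1 / 4 : ℝ)) *
            (y s ^ (1 / 4 : ℝ) * (y s + g s) ^ (1 / 4 : ℝ)) * e s ^ (1 / 2 : ℝ))
          ≤ ∫⁻ s in Ioo 0 t, (νe * (y s + g s) + Kc * e s * y s) := lintegral_mono fun s => hpt s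
        _ = νe * (∫⁻ s in Ioo 0 t, (y s + g s)) + ∫⁻ s in Ioo 0 t, Kc * e s * y s := by
            have m : AEMeasurable (fun s => Kc * e s * y s) μ := (hem.const_mul Kc).mul hym
            rw [lintegral_add_right' _ m, lintegral_const_mul' _ _ hνetop]
        _ = _ := by rw [lintegral_add_left' hym, mul_add]
    -- absorb the dissipation
    have hGtop : νe * G ≠ ⊤ := ENNReal.mul_ne_top hνetop hGfin
    have e3 : νe * G + (y t + νe * G) ≤ νe * G + (B + ∫⁻ s in Ioo 0 t, a s * y s) := by
      have hay : ∫⁻ s in Ioo 0 t, a s * y s = νe * (∫⁻ s in Ioo 0 t, y s) + ∫⁻ s in Ioo 0 t, Kc * e s * y s := by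
        rw [ha]
        dsimp only
        simp_rw [add_mul]
        rw [lintegral_add_left' (hym.const_mul νe), lintegral_const_mul' _ _ hνetop]
      calc νe * G + (y t + νe * G) = y t + 2 * νe * G := by ring
        _ ≤ _ := hD
        _ ≤ B + (νe * (∫⁻ s in Ioo 0 t, y s) + νe * G + ∫⁻ s in Ioo 0 t, Kc * e s * y s) := by gcongr
        _ = νe * G + (B + ∫⁻ s in Ioo 0 t, a s * y s) := by rw [hay]; ring
    have e4 : y t + νe * G ≤ B + ∫⁻ s in Ioo 0 t, a s * y s := (ENNReal.add_le_add_iff_left hGtop).1 e3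
    exact le_self_add.trans e4
  -- ### Grönwall on `[0, T]` for the extension `φ` of `y` by `0` at `t = 0`
  set φ : ℝ → ℝ≥0∞ := fun s => if 0 < s then y s else 0 with hφ
  have hφy : ∀ t, ∫⁻ s in Ioo 0 t, a s * φ s = ∫⁻ s in Ioo 0 t, a s * y s := by
    intro t
    refine setLIntegral_congr_fun measurableSet_Ioo fun s hs => ?_
    simp only [hφ, if_pos hs.1]
  have hM : 2 * Mu + 2 * MU ≠ ⊤ := ENNReal.add_ne_top.2
    ⟨ENNReal.mul_ne_top ENNReal.ofNat_ne_top hMu, ENNReal.mul_ne_top ENNReal.ofNat_ne_top hMU⟩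
  have hφM : ∀ t ∈ Icc 0 T, φ t ≤ 2 * Mu + 2 * MU := by
    intro t ht
    by_cases h0 : 0 < t
    · simp only [hφ, if_pos h0]; exact hybound t ⟨h0, ht.2⟩
    · simp only [hφ, if_neg h0]; exact bot_le
  have hφmain : ∀ t ∈ Icc 0 T, φ t ≤ B + ∫⁻ s in Ioo 0 t, a s * φ s := by
    intro t ht
    rw [hφy]
    by_cases h0 : 0 < t
    · simp only [hφ, if_pos h0]; exact hmain t ⟨h0, ht.2⟩
    · simp only [hφ, if_neg h0]; exact bot_le
  have hG := lintegral_gronwall_le (S := T) (φ := φ) (a := a) hBtop hM hφM haT hφmain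
  intro t ht
  have h := hG t ⟨ht.1.le, ht.2⟩
  simp only [hφ, if_pos ht.1] at h
  have hker : ∫⁻ s in Ioo 0 t, (ENNReal.ofReal ν + (ENNReal.ofReal ν)⁻¹ * (2 * (9 * Torus.anisotropicConst)) ^ 2 *
      Torus.eGradNormSq (U s)) = ∫⁻ s in Ioo 0 t, a s :=
    lintegral_congr fun s => ha' s
  rw [hker]
  exact h

/-- **The Grönwall exponent is finite and explicitly bounded**: along an unforced Leray–Hopf
solution `U` on `T³ × [0,T)` with viscosity `ν > 0` and datum `U₀`, for `t ∈ [0,T]`,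
`∫₀ᵗ (ν + ν⁻¹(18C)²‖∇U‖₂²) ≤ ν t + 162 C² ‖U₀‖₂² / ν²`, by the energy inequality
`‖U(t)‖₂² + 2ν∫₀ᵗ‖∇U‖₂² ≤ ‖U₀‖₂²` (Bardos–Lopes Filho–Niu–Nussenzveig Lopes–Titi 2013, end of
the proof of Thm. 3.1: "we use again the Ladyzhenskaya inequality … together with (the energy
inequality)"). [cite: BardosEtAl2013, Thm. 3.1 (proof)] -/
theorem Torus.IsLerayHopfOn.toReal_lintegral_stabilityKernel_le {T ν : ℝ}
    {U : ℝ → UnitAddTorus (Fin 3) → EuclideanSpace ℝ (Fin 3)} {U₀ : UnitAddTorus (Fin 3) → EuclideanSpace ℝ (Fin 3)}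
    (hU : Torus.IsLerayHopfOn T ν 0 U₀ U) (hν : 0 < ν) {t : ℝ} (ht : t ∈ Icc 0 T) :
    (∫⁻ s in Ioo 0 t, (ENNReal.ofReal ν +
        (ENNReal.ofReal ν)⁻¹ * (2 * (9 * Torus.anisotropicConst)) ^ 2 * Torus.eGradNormSq (U s))) ≠ ⊤ ∧
      (∫⁻ s in Ioo 0 t, (ENNReal.ofReal ν +
        (ENNReal.ofReal ν)⁻¹ * (2 * (9 * Torus.anisotropicConst)) ^ 2 * Torus.eGradNormSq (U s))).toReal ≤
        ν * t + 162 * Torus.anisotropicConst.toReal ^ 2 / ν ^ 2 * ∫ x, ‖U₀ x‖ ^ 2 := by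
  set νe : ℝ≥0∞ := ENNReal.ofReal ν with hνe
  have hνe0 : νe ≠ 0 := by rw [hνe]; simpa using hν
  have hνetop : νe ≠ ⊤ := ENNReal.ofReal_ne_top
  set Kc : ℝ≥0∞ := νe⁻¹ * (2 * (9 * Torus.anisotropicConst)) ^ 2 with hKc
  have hC9top : (9 : ℝ≥0∞) * Torus.anisotropicConst ≠ ⊤ := ENNReal.mul_ne_top (by norm_num) Torus.anisotropicConst_ne_top
  have hKctop : Kc ≠ ⊤ := ENNReal.mul_ne_top (ENNReal.inv_ne_top.2 hνe0)
    (ENNReal.pow_ne_top (ENNReal.mul_ne_top ENNReal.ofNat_ne_top hC9top))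
  set E : ℝ≥0∞ := ∫⁻ s in Ioo 0 t, Torus.eGradNormSq (U s) with hE
  have hEtop : E ≠ ⊤ :=
    ne_top_of_le_ne_top hU.lintegral_eGradNormSq_lt_top.ne (lintegral_mono_set (Ioo_subset_Ioo le_rfl ht.2))
  have hsplit : ∫⁻ s in Ioo 0 t, (ENNReal.ofReal ν +
      (ENNReal.ofReal ν)⁻¹ * (2 * (9 * Torus.anisotropicConst)) ^ 2 * Torus.eGradNormSq (U s)) =
      νe * ENNReal.ofReal t + Kc * E := by
    have : (fun s => ENNReal.ofReal ν + (ENNReal.ofReal ν)⁻¹ * (2 * (9 * Torus.anisotropicConst)) ^ 2 *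
        Torus.eGradNormSq (U s)) = fun s => νe + Kc * Torus.eGradNormSq (U s) := by
      funext s; simp only [hνe, hKc]
    rw [this, lintegral_add_left' aemeasurable_const, lintegral_const_mul' _ _ hKctop, setLIntegral_const,
      Real.volume_Ioo, sub_zero]
  have h1top : νe * ENNReal.ofReal t ≠ ⊤ := ENNReal.mul_ne_top hνetop ENNReal.ofReal_ne_top
  have h2top : Kc * E ≠ ⊤ := ENNReal.mul_ne_top hKctop hEtop
  refine ⟨by rw [hsplit]; exact ENNReal.add_ne_top.2 ⟨h1top, h2top⟩, ?_⟩
  rw [hsplit, ENNReal.toReal_add h1top h2top, ENNReal.toReal_mul, ENNReal.toReal_mul, hνe,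
    ENNReal.toReal_ofReal hν.le, ENNReal.toReal_ofReal ht.1]
  -- the energy bound on `E`
  have hen := hU.integral_norm_sq_add_le_of_zero_force ht
  have hpos : 0 ≤ ∫ x, ‖U t x‖ ^ 2 := integral_nonneg fun _ => sq_nonneg _
  have hEle : E.toReal ≤ (∫ x, ‖U₀ x‖ ^ 2) / (2 * ν) := by
    rw [le_div_iff₀ (by positivity)]
    nlinarith [ENNReal.toReal_nonneg (a := E)]
  have hKc' : Kc.toReal = ν⁻¹ * (2 * (9 * Torus.anisotropicConst.toReal)) ^ 2 := by
    rw [hKc, ENNReal.toReal_mul, ENNReal.toReal_inv, hνe, ENNReal.toReal_ofReal hν.le, ENNReal.toReal_pow,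
      ENNReal.toReal_mul, ENNReal.toReal_mul, ENNReal.toReal_ofNat, ENNReal.toReal_ofNat]
  rw [hKc']
  have hU₀ : 0 ≤ ∫ x, ‖U₀ x‖ ^ 2 := integral_nonneg fun _ => sq_nonneg _
  have hsq : 0 ≤ (2 * (9 * Torus.anisotropicConst.toReal)) ^ 2 := sq_nonneg _
  calc ν * t + ν⁻¹ * (2 * (9 * Torus.anisotropicConst.toReal)) ^ 2 * E.toReal
      ≤ ν * t + ν⁻¹ * (2 * (9 * Torus.anisotropicConst.toReal)) ^ 2 * ((∫ x, ‖U₀ x‖ ^ 2) / (2 * ν)) := by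
        gcongr
    _ = ν * t + 162 * Torus.anisotropicConst.toReal ^ 2 / ν ^ 2 * ∫ x, ‖U₀ x‖ ^ 2 := by
        field_simp
        ring

/-- **Stability of `x₃`-independent Leray–Hopf flows under three-dimensional perturbations on
`T³`, explicit real form** (Bardos–Lopes Filho–Niu–Nussenzveig Lopes–Titi 2013, Thm. 3.1,
printed for `D × (0,L)` with constant `exp(27‖u₀‖⁴_{L²}/(64ν⁴))`; here on the flat torus with
the inhomogeneous Ladyzhenskaya constant of the tree): for unforced Leray–Hopf solutions `u`
(datum `u₀ ∈ L²`) and `U` (datum `U₀ ∈ L²`, every slice independent of `x₃`) with viscosity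
`ν > 0` on `T³ × [0,T)`, and every `t ∈ (0,T]`,
`∫‖u(t) - U(t)‖² ≤ ∫‖u₀ - U₀‖² · exp(ν t + 162 C² ‖U₀‖₂² / ν²)`, `C = Torus.anisotropicConst`
(real; the printed estimate is for all `t ≥ 0` on the cylinder, here `t ∈ (0,T]` for solutions on
`[0,T)`). [cite: BardosEtAl2013, Thm. 3.1] -/
theorem Torus.IsLerayHopfOn.integral_norm_sub_sq_le_mul_exp_of_invariant {T ν : ℝ}
    {u U : ℝ → UnitAddTorus (Fin 3) → EuclideanSpace ℝ (Fin 3)}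
    {u₀ U₀ : UnitAddTorus (Fin 3) → EuclideanSpace ℝ (Fin 3)}
    (hu : Torus.IsLerayHopfOn T ν 0 u₀ u) (hU : Torus.IsLerayHopfOn T ν 0 U₀ U) (hν : 0 < ν) (hT : 0 < T)
    (hu₀ : MemLp u₀ 2 volume) (hU₀ : MemLp U₀ 2 volume)
    (hUinv : ∀ (t : ℝ) (s : UnitAddCircle) (x : UnitAddTorus (Fin 3)), U t (x + Pi.single (2 : Fin 3) s) = U t x)
    {t : ℝ} (ht : t ∈ Ioc 0 T) :
    ∫ x, ‖u t x - U t x‖ ^ 2 ≤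
      (∫ x, ‖u₀ x - U₀ x‖ ^ 2) * Real.exp (ν * t + 162 * Torus.anisotropicConst.toReal ^ 2 / ν ^ 2 * ∫ x, ‖U₀ x‖ ^ 2) := by
  have ht' : t ∈ Icc 0 T := ⟨ht.1.le, ht.2⟩
  have h := hu.lintegral_enorm_sub_sq_le_mul_exp_of_invariant hU hν hT hu₀ hU₀ hUinv t ht
  have hwt : MemLp (fun x => u t x - U t x) 2 volume := (hu.memLp t ht').sub (hU.memLp t ht')
  have hw0 : MemLp (fun x => u₀ x - U₀ x) 2 volume := hu₀.sub hU₀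
  rw [Torus.lintegral_enorm_sq_eq_ofReal hwt, Torus.lintegral_enorm_sq_eq_ofReal hw0,
    ← ENNReal.ofReal_mul (integral_nonneg fun _ => sq_nonneg _)] at h
  have h' := (ENNReal.ofReal_le_ofReal_iff (mul_nonneg (integral_nonneg fun _ => sq_nonneg _)
    (Real.exp_pos _).le)).1 h
  refine h'.trans ?_
  obtain ⟨-, hk⟩ := hU.toReal_lintegral_stabilityKernel_le hν ht'
  gcongr


end Literature.Analysis.FluidPDE

end
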